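import Summits.KontsevichZagierPeriods.KontsevichZagierPeriods.Theorems.RootDecompRelativeModAbsoluteEvenCircleP2

/-! # `RootDecompRelativeModAbsoluteEvenCircleP3` — part 3/10 of the mechanical ≤400-line split of `evB_src3.lean` (sha256 9b9fc462830f2800…)
Source: decomp-kz lens-3 g14 EvenCircle.lean FINAL @ba0f3b57 §K0–§K12 (land/EvenCircleB @954ab641, lint-fixed, §K12 re-pointed at the landed CircleSplit names; critic CLEARED g7-2 l.1388: evenCircleCellClose_holds); --supports stmt-KontsevichZagierPeriods-30572.
Split by census-1 g10 `gen/splitlean.py`: scopes re-opened with their `open`/`variable`/`set_option` context; mathematics and declaration order unchanged. -/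

noncomputable section
open Set MeasureTheory
open Literature.NumberTheory.Transcendental Literature.ModelTheory.ExponentialFields
namespace Summit.KontsevichZagierPeriods.RootDecompRelativeModAbsolute.Rung30571.RegularisedLogLayer.CylLog.Leaf.G13
open Set MeasureTheory in
open Literature.NumberTheory.Transcendental Literature.ModelTheory.ExponentialFields in
/-- Auxiliary step `init_apply_zero` (§B2): init apply zero. [bookkeeping] -/
private theorem init_apply_zero (z : Fin 2 → ℝ) : Fin.init z 0 = z 0 := rfl

namespace AngleFold

open Filter Topology in
/-- **STEP 4 engine (PROVED).**  `T` an open order-convex `ℚ`-sa set with finite top end `β`; `u_b` sa, differentiable on `T`,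
with limits `K̂_b` (sa constants) at `β⁻` (only required where `p_b ≢ 0`); `p_b` sa.  If `W = ⟦Rgn T; Σ_b p_b(x) q_{n_b}(u_b ξ) u_b'(ξ)⟧` and
`R = ⟦T; Σ_b p_b (Q_{n_b}(K̂_b) − Q_{n_b}(u_b))⟧` are honest, then `[W] − [R]` is a relation (one KZ rule 3 in `ξ`, after
closing the region up to a null set). -/
theorem rgn_newton {T : Set (Fin 1 → ℝ)} (hT : IsSemialgebraic ℚ T) (hTo : IsOpen T) (hTc : OrdConv T)
    (hne : T.Nonempty) {β : ℝ} (hβ : IsLUB (bpt ⁻¹' T) β)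
    {l : ℕ} (nn : Fin l → ℕ) {p u : Fin l → (Fin 1 → ℝ) → ℝ} (K : Fin l → ℝ)
    (hp : ∀ b, IsSemialgebraicFunOn ℚ T (p b)) (hu : ∀ b, IsSemialgebraicFunOn ℚ T (u b))
    (hud : ∀ b, ∀ x ∈ T, DifferentiableAt ℝ (u b) x) (hK : ∀ b, SaConst T (K b))
    (hlim : ∀ b, (∀ x ∈ T, p b x = 0) ∨ Tendsto (fun s => u b (bpt s)) (𝓝[<] β) (𝓝 (K b)))
    (W : KZ.IntegralRep 2) (hWd : W.domain = Rgn T)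
    (hWi : EqOn W.integrand (fun z => ∑ b, p b (Fin.init z) * qk (nn b) (u b (bpt (z (Fin.last 1)))) *
      du (u b) (bpt (z (Fin.last 1)))) W.domain)
    (R : KZ.IntegralRep 1) (hRd : R.domain = T)
    (hRi : EqOn R.integrand (fun x => ∑ b, p b x * (Qk (nn b) (K b) - Qk (nn b) (u b x))) T) :
    KZ.of W - KZ.of R ∈ KZ.relations := by
  classical
  have hTm : MeasurableSet T := hT.measurableSet_holds
  have hβT : bpt β ∉ T := not_mem_of_isLUB hTo hβ
  have hltβ : ∀ x ∈ T, x 0 < β := fun x hx => lt_of_isLUB hTo hβ hx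
  have hIoo : ∀ x ∈ T, Ioo (x 0) β ⊆ bpt ⁻¹' T := fun x hx => Ioo_subset_of_isLUB hTc hβ hx
  have hβs : SaConst T β := saConst_of_isAlgebraic hT (isAlgebraic_of_isLUB hT hTo hne hβ)
  -- the closed band
  set Bc : Set (Fin 2 → ℝ) := KZlog.band T (fun x => x 0) (fun _ => β) with hBc
  have ha : IsSemialgebraicFunOn ℚ T (fun x : Fin 1 → ℝ => x 0) :=
    Literature.NumberTheory.Transcendental.isSemialgebraicFunOn_apply hT 0
  have hBsa : IsSemialgebraic ℚ Bc := KZlog.isSemialgebraic_band ha hβs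
  have hBm : MeasurableSet Bc := hBsa.measurableSet_holds
  have hRsa : IsSemialgebraic ℚ (Rgn T) := isSemialgebraic_Rgn hT
  have hRm : MeasurableSet (Rgn T) := hRsa.measurableSet_holds
  have hRB : Rgn T ⊆ Bc := fun z hz =>
    ⟨hz.1, by simpa [init_apply_zero] using hz.2.2.le, (hβ.1 (mem_preimage_bpt hz.2.1) : _)⟩
  have hvol : volume (Bc \ Rgn T) = 0 := by
    have h1 : volume {z : Fin 2 → ℝ | Fin.init z ∈ T ∧ z (Fin.last 1) = (fun x : Fin 1 → ℝ => x 0) (Fin.init z)} = 0 :=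
      KZ.volume_graph_eq_zero ha
    have h2 : volume {z : Fin 2 → ℝ | z (Fin.last 1) = β} = 0 := KZ.volume_setOf_last_eq_zero β
    refine measure_mono_null (fun z hz => ?_) (measure_union_null h1 h2)
    obtain ⟨⟨hx, hle, hleβ⟩, hnot⟩ := hz
    have hle' : z 0 ≤ z (Fin.last 1) := by simpa [init_apply_zero] using hle
    by_cases hA : z (Fin.last 1) = z 0
    · refine Or.inl ⟨hx, ?_⟩
      show z (Fin.last 1) = Fin.init z 0
      rw [init_apply_zero]; exact hA
    by_cases hB : z (Fin.last 1) = β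
    · exact Or.inr hB
    have hlt1 : z 0 < z (Fin.last 1) := lt_of_le_of_ne hle' (Ne.symm hA)
    exact (hnot ⟨hx, hIoo _ hx ⟨hlt1, lt_of_le_of_ne hleβ hB⟩, hlt1⟩).elim
  -- the closed-up rep `Wc`
  let wc : (Fin 2 → ℝ) → ℝ := fun z => if z ∈ Rgn T then W.integrand z else 0
  have hwc_sa : IsSemialgebraicFunOn ℚ Bc wc := by
    have hU : Bc = Rgn T ∪ (Bc \ Rgn T) := by rw [Set.union_sdiff_cancel hRB]
    rw [hU]
    refine IsSemialgebraicFunOn.union (hWd ▸ W.isSemialgebraicFunOn_integrand)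
      (isSemialgebraicFunOn_ratCast (hBsa.diff hRsa) 0) (fun z hz => if_pos hz)
      fun z hz => by show wc z = ((0:ℚ):ℝ); rw [Rat.cast_zero]; exact if_neg hz.2
  have hwc_int : IntegrableOn wc Bc := by
    have h1 : IntegrableOn W.integrand (Rgn T) := hWd ▸ W.integrableOn
    have h2 : wc = (Rgn T).indicator W.integrand := by
      funext z; by_cases hz : z ∈ Rgn T <;> simp [wc, indicator, hz]
    rw [h2, IntegrableOn, integrable_indicator_iff hRm, IntegrableOn, Measure.restrict_restrict hRm,
      inter_eq_self_of_subset_left hRB]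
    exact h1
  let Wc : KZ.IntegralRep 2 := ⟨Bc, wc, hBsa, hwc_sa, hwc_int⟩
  -- `W` versus `Wc`
  have r1 : KZ.of Wc - KZ.of (Wc.restrict _ hRsa hRB) ∈ KZ.relations :=
    Wc.of_sub_of_restrict_mem_relations hRsa hRB hvol
  have r2 : KZ.of (Wc.restrict _ hRsa hRB) - KZ.of W ∈ KZ.relations :=
    KZ.of_sub_of_mem_relations_of_eqOn hWd fun z hz => by
      show wc z = W.integrand z
      exact if_pos hz
  -- the primitive
  let F : (Fin 2 → ℝ) → ℝ := fun z => if bpt (z (Fin.last 1)) ∈ T then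
      ∑ b, p b (Fin.init z) * Qk (nn b) (u b (bpt (z (Fin.last 1)))) else ∑ b, p b (Fin.init z) * Qk (nn b) (K b)
  have hB1 : Bc ⊆ {z : Fin 2 → ℝ | Fin.init z ∈ T} := fun z hz => hz.1
  have hS1 : IsSemialgebraic ℚ (Bc ∩ {z : Fin 2 → ℝ | bpt (z (Fin.last 1)) ∈ T}) :=
    hBsa.inter (isSemialgebraic_setOf_bpt_mem hT _)
  have hS2 : IsSemialgebraic ℚ (Bc \ {z : Fin 2 → ℝ | bpt (z (Fin.last 1)) ∈ T}) :=
    hBsa.diff (isSemialgebraic_setOf_bpt_mem hT _)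
  have hF_sa : IsSemialgebraicFunOn ℚ Bc F := by
    have hf : IsSemialgebraicFunOn ℚ (Bc ∩ {z : Fin 2 → ℝ | bpt (z (Fin.last 1)) ∈ T})
        (fun z => ∑ b, p b (Fin.init z) * Qk (nn b) (u b (bpt (z (Fin.last 1))))) := by
      refine KZ.isSemialgebraicFunOn_finset_sum Finset.univ hS1 fun b _ => ?_
      exact ((hp b).comp_init.mono (fun z hz => hB1 hz.1) hS1).mul_holds
        (sa_Qk hS1 (((sa_comp_bpt (hu b) (Fin.last 1)).mono (fun z hz => hz.2) hS1)) (nn b))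
    have hg : IsSemialgebraicFunOn ℚ (Bc \ {z : Fin 2 → ℝ | bpt (z (Fin.last 1)) ∈ T})
        (fun z => ∑ b, p b (Fin.init z) * Qk (nn b) (K b)) := by
      refine KZ.isSemialgebraicFunOn_finset_sum Finset.univ hS2 fun b _ => ?_
      exact ((hp b).comp_init.mono (fun z hz => hB1 hz.1) hS2).mul_holds
        (sa_Qk hS2 (((hK b).comp_init.mono (fun z hz => hB1 hz.1) hS2)) (nn b))
    have hU : Bc = (Bc ∩ {z : Fin 2 → ℝ | bpt (z (Fin.last 1)) ∈ T}) ∪ (Bc \ {z : Fin 2 → ℝ | bpt (z (Fin.last 1)) ∈ T}) :=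
      (Set.inter_union_sdiff Bc _).symm
    rw [hU]
    exact IsSemialgebraicFunOn.union hf hg (fun z hz => if_pos hz.2) fun z hz => if_neg hz.2
  -- fibrewise calculus
  have hFsnoc : ∀ (x : Fin 1 → ℝ) (t : ℝ), F (Fin.snoc x t) = if bpt t ∈ T then
      ∑ b, p b x * Qk (nn b) (u b (bpt t)) else ∑ b, p b x * Qk (nn b) (K b) := by
    intro x t; simp only [F, Fin.init_snoc, Fin.snoc_last]
  have hcontT : ∀ b, ∀ s ∈ bpt ⁻¹' T, ContinuousAt (fun s => u b (bpt s)) s := fun b s hs =>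
    (hasDerivAt_comp_bpt (hud b _ hs)).continuousAt
  have hopen : IsOpen (bpt ⁻¹' T) := isOpen_preimage_bpt hTo
  have hderF : ∀ x ∈ T, ∀ t ∈ Ioo (x 0) β, HasDerivAt (fun s : ℝ => F (Fin.snoc x s))
      (∑ b, p b x * qk (nn b) (u b (bpt t)) * du (u b) (bpt t)) t := by
    intro x hx t ht
    have htT : bpt t ∈ T := hIoo x hx ht
    have hev : (fun s : ℝ => F (Fin.snoc x s)) =ᶠ[𝓝 t] fun s => ∑ b, p b x * Qk (nn b) (u b (bpt s)) := by
      filter_upwards [hopen.mem_nhds htT] with s hs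
      have hs' : bpt s ∈ T := hs
      rw [hFsnoc, if_pos hs']
    refine HasDerivAt.congr_of_eventuallyEq ?_ hev
    have := HasDerivAt.sum (u := Finset.univ) fun b _ =>
      (((hasDerivAt_Qk (nn b) _).comp t (hasDerivAt_comp_bpt (hud b _ htT))).const_mul (p b x))
    simp only [Finset.sum_fn] at this ⊢
    refine this.congr_deriv (Finset.sum_congr rfl fun b _ => by ring)
  have hcontF : ∀ x ∈ T, ContinuousOn (fun t : ℝ => F (Fin.snoc x t)) (Icc (x 0) β) := by
    intro x hx t ht
    rcases lt_or_eq_of_le ht.2 with hlt | heq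
    · -- interior or left end: `bpt t ∈ T`
      have htT : bpt t ∈ T := by
        rcases lt_or_eq_of_le ht.1 with h0 | h0
        · exact hIoo x hx ⟨h0, hlt⟩
        · rw [← h0, bpt_apply_zero]; exact hx
      have hev : (fun s : ℝ => F (Fin.snoc x s)) =ᶠ[𝓝 t] fun s => ∑ b, p b x * Qk (nn b) (u b (bpt s)) := by
        filter_upwards [hopen.mem_nhds htT] with s hs
        have hs' : bpt s ∈ T := hs
        rw [hFsnoc, if_pos hs']
      refine (ContinuousAt.congr ?_ hev.symm).continuousWithinAt
      have hta : Tendsto (fun s : ℝ => ∑ b, p b x * Qk (nn b) (u b (bpt s))) (𝓝 t)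
          (𝓝 (∑ b, p b x * Qk (nn b) (u b (bpt t)))) :=
        tendsto_finsetSum _ fun b _ => (((continuous_Qk (nn b)).tendsto _).comp (hcontT b t htT)).const_mul (p b x)
      exact hta
    · -- the top end `t = β`: left limit
      rw [heq]
      have hval : F (Fin.snoc x β) = ∑ b, p b x * Qk (nn b) (K b) := by rw [hFsnoc, if_neg hβT]
      have hlim' : Tendsto (fun s : ℝ => F (Fin.snoc x s)) (𝓝[<] β) (𝓝 (F (Fin.snoc x β))) := by
        rw [hval]
        have hev : (fun s : ℝ => F (Fin.snoc x s)) =ᶠ[𝓝[<] β] fun s => ∑ b, p b x * Qk (nn b) (u b (bpt s)) := by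
          filter_upwards [Ioo_mem_nhdsLT (hltβ x hx)] with s hs
          have hs' : bpt s ∈ T := hIoo x hx hs
          rw [hFsnoc, if_pos hs']
        refine Tendsto.congr' hev.symm ?_
        refine tendsto_finsetSum _ fun b _ => ?_
        rcases hlim b with h0 | hl
        · simp only [h0 x hx, zero_mul]; exact tendsto_const_nhds
        · exact (((continuous_Qk (nn b)).tendsto (K b)).comp hl).const_mul (p b x)
      have hIic : ContinuousWithinAt (fun s : ℝ => F (Fin.snoc x s)) (Iic β) β :=
        continuousWithinAt_Iio_iff_Iic.1 hlim'
      exact hIic.mono fun s hs => hs.2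
  -- the Newton–Leibniz relation
  have r3 : KZ.of Wc - KZ.of R ∈ KZ.relations := by
    refine KZ.newtonLeibnizRel_subset_relations ⟨1, Wc, R, fun x => x 0, fun _ => β, F, hF_sa,
      hRd ▸ ha, hRd ▸ hβs, fun x hx => (hltβ x (hRd ▸ hx)).le, ?_, fun x hx => hcontF x (hRd ▸ hx),
      fun x hx t ht => ?_, fun x hx => ?_, rfl⟩
    · show Bc = _
      rw [hRd]; rfl
    · have hxT : x ∈ T := hRd ▸ hx
      have hmem : (Fin.snoc x t : Fin 2 → ℝ) ∈ Rgn T := by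
        refine ⟨by rw [Fin.init_snoc]; exact hxT, by rw [Fin.snoc_last]; exact hIoo x hxT ht, ?_⟩
        show (Fin.snoc x t : Fin 2 → ℝ) 0 < (Fin.snoc x t : Fin 2 → ℝ) (Fin.last 1)
        rw [Fin.snoc_last, show (0 : Fin 2) = Fin.castSucc (0 : Fin 1) from rfl, Fin.snoc_castSucc]
        exact ht.1
      have hWc : Wc.integrand (Fin.snoc x t) = ∑ b, p b x * qk (nn b) (u b (bpt t)) * du (u b) (bpt t) := by
        show wc (Fin.snoc x t) = _
        simp only [wc, if_pos hmem]
        rw [hWi (hWd ▸ hmem)]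
        simp only [Fin.init_snoc, Fin.snoc_last]
      rw [hWc]
      exact hderF x hxT t ht
    · have hxT : x ∈ T := hRd ▸ hx
      rw [hRi hxT, hFsnoc, hFsnoc, if_neg hβT, if_pos (by rw [bpt_apply_zero]; exact hxT), bpt_apply_zero,
        ← Finset.sum_sub_distrib]
      exact Finset.sum_congr rfl fun b _ => by ring
  have e : KZ.of W - KZ.of R = (KZ.of Wc - KZ.of R) - (KZ.of Wc - KZ.of (Wc.restrict _ hRsa hRB)) -
      (KZ.of (Wc.restrict _ hRsa hRB) - KZ.of W) := by abel
  rw [e]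
  exact sub_mem (sub_mem r3 r1) r2

/-! ### §K4 The increasing piece with finite top value (regime (a), `u ↑ d < ∞`): `⟦0 ≤ s ≤ u(x)⟧ = ⟦0 ≤ s ≤ d⟧ − ⟦u(x) < s < d⟧`,
the second band being the image of `Rgn T` under `s = u(ξ)`. -/

end AngleFold
end Summit.KontsevichZagierPeriods.RootDecompRelativeModAbsolute.Rung30571.RegularisedLogLayer.CylLog.Leaf.G13
end
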